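import Summits.AtomisticToContinuum.Crystallization.Theorems.TornFree.Negative.BetaMn

/-!
# `TornFree` (stmt-AtomisticToContinuum-18069), negative side: the CORNER of the β-manganese
# quadrant — `¬ TornFreeTol (29/500) (1293/1000)`

`BetaMn.lean` certified the two members `(29/500, 63/50)` and `(3/50, 129/100)` with two different
relaxed β-Mn point sets.  The FIRST point set (`betaMnL`, `betaMnP`, scale `D = 10000`, window
`[9420, 10580]`) in fact has its smallest non-bonded squared distance equal to `167284018 =
(12933.8…)²`, so the very same integer data certify the gap up to `γ = 1293/1000`
(`gam2 = 12930² = 167184900`); this file replays that wider certificate.  The resulting member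
`(29/500, 1293/1000)` dominates both members of `BetaMn.lean` under `TolMonotone`
(`not_tornFreeTol_of_le`: larger tolerance / smaller gap ratio), so the refuted β-Mn region is the
single quadrant `29/500 ≤ τ`, `γ ≤ 1293/1000` (with the window below the gap, `1 + τ < 1293/1000`).

WHY THIS IS THE CORNER (numerics of the refuter seat g3, 2026-08-17, fixed-topology minimax polish of
the β-Mn bond graph, pure-python L-BFGS + bisection, all 60 coordinates and the cubic/orthorhombic
box free): the minimal shell half-width of the β-Mn topology is `τ_min = 0.057637` for EVERY gap
ratio tried (`γ = 1.10, 1.16, 1.26`), with the gap constraints inactive (thirteenth neighbour at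
`1.29337·a₀` at the optimum).  So `0.0576` is intrinsic to the β-Mn twelve-shells (46 active BOND
constraints: five-ring Mn1–Mn1 bonds at the bottom of the window against bonds at the top), and the
β-Mn family cannot enter the open strip `1/50 ≤ τ < 29/500` at ANY gap ratio: a witness there needs
a different bond topology.  (Hypothesis analysis on the Negative/ lane; no route item is concluded
positively.)  Refuter seat refuter-cdisprove-stmt-AtomisticToContinuum-18069-g3-0.
-/

noncomputable section

namespace Summit.AtomisticToContinuum.Crystallization.Theorems.TornFree.Negative

open Literature.Geometry.DiscreteGeometry

set_option maxRecDepth 100000 in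
set_option maxHeartbeats 4000000 in
/-- The β-Mn integer certificate of `BetaMn.lean` with the gap pushed to its limit:
window `[9420, 10580]` (tolerance `29/500` at scale `10000`), empty annulus up to `12930`
(gap ratio `1293/1000`). [folklore] -/
theorem betaMnWide_cert : Cert 20 betaMnL betaMnP 88736400 111936400 167184900 :=
  ⟨by decide, by decide, by decide, by decide, by decide, by decide, by decide⟩

/-- **β-Mn refutes the `(29/500, 1293/1000)` member**: an infinite periodic configuration (relaxed
β-manganese) in which every site is gapped-twelve at `(a, 29/500, 1293/1000)` has a bond with only
three common bonded neighbours.  This single member implies both members of `BetaMn.lean`. [folklore] -/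
theorem not_tornFreeTol_betaMnWide : ¬ TornFreeTol (29 / 500) (1293 / 1000) :=
  not_tornFreeTol_of_cert betaMnWide_cert (29 / 500) (1293 / 1000) 10000 (by norm_num) (by norm_num)
    (by norm_num) (by norm_num) (by norm_num) (by norm_num) (by norm_num) 1 8 4 (by decide)
    betaMn_bond betaMn_commons_le

/-- The β-Mn quadrant in one statement: every member with tolerance `≥ 29/500` and gap ratio
`≤ 1293/1000` (window below the gap) is false.  In particular any proof of the crux
(`(1/50, 63/50)`) must use `τ < 29/500`; enlarging the gap ratio up to `1.293` does not help. [folklore] -/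
theorem not_tornFreeTol_of_betaMnWide {τ γ : ℝ} (hτ : 29 / 500 ≤ τ) (hγ : γ ≤ 1293 / 1000)
    (hgap : 1 + τ < 1293 / 1000) : ¬ TornFreeTol τ γ :=
  not_tornFreeTol_of_le hτ hγ hgap not_tornFreeTol_betaMnWide

/-- Sanity link: the two members certified in `BetaMn.lean` are instances of the wide quadrant. -/
example : ¬ TornFreeTol (29 / 500) (63 / 50) ∧ ¬ TornFreeTol (3 / 50) (129 / 100) :=
  ⟨not_tornFreeTol_of_betaMnWide le_rfl (by norm_num) (by norm_num),
   not_tornFreeTol_of_betaMnWide (by norm_num) (by norm_num) (by norm_num)⟩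

end Summit.AtomisticToContinuum.Crystallization.Theorems.TornFree.Negative

end
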